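import Literature.MathematicalPhysics.QuantumFieldTheory.Balaban1983to89.B2Eq39ConcreteForms
import Literature.MathematicalPhysics.QuantumFieldTheory.Balaban1983to89.HiggsCondGauss228

/-!
# `Balaban1983to89.B2Eq37RemainingIntegral` — T. Bałaban, *(Higgs)₂,₃ quantum fields in a finite volume. II. An upper bound*,
Commun. Math. Phys. **86** (1982) 555–594 [Balaban1982Higgs2] p. 584 [PDF 30]: the display **(3.7)** — *"the remaining terms"*
of the inductive hypothesis (3.5) at the `k`-th scale *"which do … depend on A_k, φ_k↾Λ₅⁽ᵏ⁾"*, i.e. THE INTEGRAL OVER THE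
FIELDS `A_k↾_{Λ₅⁽ᵏ⁾}`, `φ_k↾_{Λ₅⁽ᵏ⁾}` that §3.A goes on to transform into the Gaussian integral (3.9) — AS DISPLAYED, WITH A BODY,
on the concrete (Higgs)₂,₃ carrier (the member *"(3.7): none"* of SKELETON row B2.Eq3.1-3.10), and two kernel-checked sentences
about it: the density factor `ρ′⁽ᵏ⁾(…, Λ₇^{(k−1)′c}A_k, Ã⁽ᵏ⁾, Λ₇^{(k−1)′c}φ_k)` does not see the integrated fields
(`display37_factor`), and THE QUADRATIC PART OF THE TWO AVERAGING LINES IN THE INTEGRATED FIELDS IS p23 g11's (3.9)-OBJECT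
`B2Eq39ConcreteForms.Geom39.sqForm39` (`sqVec37_split`, `sqScal37_split`)

statement-level skeleton of published theorems with citation tags; proofs where landed; nothing here is a claim about the Yang–Mills mass gap

PDF held: `paper:balaban1982-cmp86-higgs23-ii` (journal page = PDF page + 554); pp. 583–585 [PDF 29–31] READ AS IMAGES on the
×2.5 renders of the pulled `run/shared/lit/papers/balaban1982-cmp86-higgs23-ii/original.pdf` (this seat's `work/renders/c2-p029/030/031.png`;
the OCR layer `p0030.txt` garbles every display of the page); the second reader's symbol-by-symbol transcription of (3.5)–(3.7)
(ROWS-B2 row B2.Eq3.1-3.10, r14 g11 SECONDREAD-B2 v25.1) was compared and CONCURS.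

CITATION HEADER (lean-in-tree rule).  lit-balaban typed skeleton (HOME `run/shared/lean/pub/lit-balaban/`), Phase-2 proof seat
**p23** gen 25 (unit `lit-balaban-p23-g25`; TAKING #2 line HOME/STATUS.md 2026-08-23T20:00:56Z; fold-owner consent r02 g52 →
p23 2026-08-23T18:19:28Z *"(3.7) display member: YES, TAKE IT under p23's name"*).  SKELETON row **B2.Eq3.1-3.10** ((3.1)–(3.10)
pp. 583–585; owner r02, second reader r14, referee ref-4; born ROWS-B2 v2.54 `typed p309492 (partial …)`; located members
(3.1)/(3.5)/(3.8)/(3.10) `B2Sect3AStatements` (r02 p311500, schematic), (3.2)–(3.4) `B2Eq32FieldRegularity.field32` (p23 g10),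
(3.3) `B2Lemma23HiggsLattice.cutMin` (r14), (3.6) `B2Eq36ScaleDecomposition` (r02 p311241), (3.9)/(3.11) `B2Eq39ConcreteForms`
(p23 g11 p312083/p314286) and `B2Sect3AGaussianStep`; *"absent: (3.7) ONLY"* — THIS FILE).  USED BY NAME, NOTHING RESTATED:
p23 g11 `B2Eq39ConcreteForms.{Geom39, Geom39.sqForm39, avgQIter}` (the geometry of ONE integral (3.9) and its averaging squares,
the composite averagings `Q_{l−k}` started at level `k`), p35 `B1Eq230FluctCov.deltaKA` (`Δ^{(k),Lᵏε}(Ω, Ã)`, I (2.21)), the typer's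
`HiggsLattice.siteInner` (I (1.5)), `B2Eq255Concrete.{cutTo, cutToLin}`, `HiggsCondGauss228.{inSet, fieldOfCrd}` and
`B2Eq228Conditioning.{In, glue}` (configurations on `Λ` as coordinates, II (2.28)), b2b `B1.aSeq` (I (2.15)),
`B3MultiscaleFields.zeroCharge` (the vector species as the scalar machinery at trivial coupling, the convention of
`B2Eq246PairStep`/`B2Eq245Assembled`).  The precedent for typing a display of the inductive definition with print's
constructions as NAMED DATA is r02 g52 `B2Eq245Assembled` ((2.45)/(2.46), `Data245`).

THE SOURCE TEXT, p. 584 [PDF 30], verbatim (read on the render).  After (3.6): *"and to each set Λ₅^{(l−1)′}∩Λ₅^{(l)c} there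
corresponds a set of characteristic functions and a sequence of partial renormalization transformations localized in this set. In
this point we will use only the functions χ_{l,Λ₅^{(l)c}} giving the suitable restrictions on the fields A_l, φ_l considered on the set
Λ₅^{(l−1)′}∩Λ₅^{(l)c}. All the partial renormalization transformations defined on the sets B^{l−j}(Λ₋₁^{(l−1)}∩Λ₅^{(l)c}), k ≦ j < l, can
be composed according to formula (I.2.12) of Chap. I.2. We have to notice that the vector fields, with respect to which the integration
is done when the composition is formed, do not occur in the correspondingly localized configuration Ã^{(k),ε}. Let us omit from the
right side of (3.36) [sic; = (3.5), GAPS G-B2-11] the composed transformations which do not depend on A_k, φ_k↾Λ₅⁽ᵏ⁾. The remaining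
terms, after rescaling from Lᵏε-lattice to 1-lattice and removing numerical factors, can be written as follows:
χ_K χ_{K−1,Λ₅^{(K−1)c}} ⋯ χ_{k,Λ₅^{(k)c}} ∫dA_k↾_{Λ₅⁽ᵏ⁾} ∫dφ_k↾_{Λ₅⁽ᵏ⁾} · ρ′⁽ᵏ⁾(Λ₀⁽⁰⁾, …, Λ₀^{(k−1)}, Λ₇^{(k−1)′c}A_k, Ã⁽ᵏ⁾, Λ₇^{(k−1)′c}φ_k)
· exp[ − Σ_{l=k+1}^{K} ½a_{l−k}(L^{l−k})^{d−2} Σ_{x_l∈Λ₅^{(l−1)′}∩Λ₅^{(l)c}} |A_l(x_l) − (Q_{l−k}A_k)(x_l)|²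
− Σ_{l=k+1}^{K} ½a_{l−k}(L^{l−k})^{d−2} Σ_{x_l∈Λ₅^{(l−1)′}∩Λ₅^{(l)c}} |φ_l(x_l) − (Q_{l−k}(Ã^{(k+1)})φ_k)(x_l)|²
− ½⟨Λ₆^{(k−1)′}A_k, Δ⁽ᵏ⁾Λ₆^{(k−1)′}A_k⟩ − ½⟨Λ₆^{(k−1)′}φ_k, Δ⁽ᵏ⁾(Bᵏ(Λ₂^{(k−1)′}), Ã⁽ᵏ⁾)Λ₆^{(k−1)′}φ_k⟩ + ½⟨Λ₆^{(k−1)′}φ_k, H_kΛ₆^{(k−1)′}φ_k⟩ ]. (3.7)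
Also we have applied formula (2.108) together with the remark following it to the expression in the exponent in (3.5). According to
the remark, the matrix elements h_k(x, x′) of the operator H_k satisfy the estimates |h_k(x, x′)| ≦ O(1)exp(−δ₁r(Lᵏε))exp(−δ₀|x − x′|),
x, x′ ∈ Λ₆^{(k−1)′}. (3.8)  Further we apply formula (2.49) and we replace ρ′⁽ᵏ⁾ exp[(the proper quadratic forms)] by ρ⁽ᵏ⁾. Next we
complete and transform the quadratic forms in ρ⁽ᵏ⁾ to the forms appearing in formula (2.46) for the density ρ″⁽ᵏ⁾. The differences
can be written again as the forms satisfying the property (3.8)."*  p. 585 [PDF 31]: *"Let us consider formula (2.46) for the density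
ρ″⁽ᵏ⁾, and let us take these expressions which depend on the fields A_k↾_{Λ₅⁽ᵏ⁾}, φ_k↾_{Λ₅⁽ᵏ⁾}. Then the integral (3.7), after removing
all the terms independent of these fields, is of the form"* (3.9); *"Let us denote the quadratic forms in A_k, φ_k, connected with the
first four terms in the exponential under the integral (3.9), by ⟨A_k, G′_kA_k⟩, ⟨φ_k, G″_kφ_k⟩ correspondingly."*  p. 583: (3.4)
*"Ã^{(k),ε} = Σ_{l=k}^{K−1}(1 − θ_{l+1})θ_lA^{(l),ε} + θ_KA^{(K),ε}"*; p. 566: *"Λ₀^{(j+1)} ⊂ Λ₇^{(j)′}"* (admissible sequences), (2.8)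
`Λ₇⁽ᵏ⁾ ⊂ Λ₆⁽ᵏ⁾ ⊂ Λ₅⁽ᵏ⁾ ⊂ ⋯ ⊂ Λ₀⁽ᵏ⁾`; I p. 605: the Lebesgue measures on the configuration spaces.

HOW IT IS TYPED (step `k ↦ G.j + 1`, the level of p23 g11's `Geom39`; physical units throughout — the typer's convention and
`B2Eq39ConcreteForms`' UNITS paragraph: print's unit-lattice coefficient `½a_{l−k}(L^{l−k})^{d−2}Σ_{x_l}|·|²` is
`½a_{l−k}(Lˡε)^{−2}‖·‖²_{T^{(l)}}`, `‖f‖²_{T^{(l)}} = (Lˡε)ᵈΣ|f|²` = `siteInner` at level `l`).  The geometry — the level `k`, the region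
`Λ₅⁽ᵏ⁾ ⊂ T⁽ᵏ⁾`, the number `M = K − k` of higher levels and the pieces `Λ₅^{(l−1)′}∩Λ₅^{(l)c} ⊂ T^{(l)}`, `l = k + n` — IS a
`Geom39` (so that the (3.9) objects apply verbatim); the masks `Λ₆^{(k−1)′}`, `Λ₇^{(k−1)′}` are sets of sites of `T⁽ᵏ⁾` (print's primed
sets ARE sets of the next scale; *"We will use the same notations for the sets in different scales"*, p. 566); `Bᵏ(Λ₂^{(k−1)′}) ⊂ T_ε`
is the Neumann region of the scalar operator; `Ã⁽ᵏ⁾`, `Ã^{(k+1)}` ((3.4)) are bond fields on `T_ε`; the fields `A_l`, `φ_l`, `l ≥ k`,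
are site functions of their levels (vector fields `ℝᵈ`-valued, p. 555 *"Vector field configurations are the functions A : T_ε → Rᵈ"*,
handled by the scalar machinery at `zeroCharge`, field `0`, as in `B2Eq245Assembled`); the characteristic functions `χ_{k,Λ₅^{(k)c}}`,
`χ_{l,Λ₅^{(l)c}}` (`k < l < K`), `χ_K` are functions of the fields of their level; `ρ′⁽ᵏ⁾(Λ₀⁽⁰⁾,…,Λ₀^{(k−1)}, ·, ·, ·)` is a function of
`(A, Ã, φ)` ((2.47)); `H_k` is a linear operator on the scalar fields of `T⁽ᵏ⁾` ((2.108)–(2.109)) — all NAMED DATA (`Data37`), as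
print constructs them elsewhere ((2.4)–(2.6)′, (2.44), (2.47), (2.108), (3.2)–(3.4); in the tree: `B2Eq32FieldRegularity`,
`B2Eq244Cutoff`/`B2Eq245Theta`, `B2Sect2BDensities`, `B2Ineq2109HiggsLattice.Inst.Hk`).  `∫dA_k↾_{Λ₅⁽ᵏ⁾}`, `∫dφ_k↾_{Λ₅⁽ᵏ⁾}` are the
Lebesgue integrals over the INTERIOR coordinates `In (inSet · Λ₅⁽ᵏ⁾) → ℝ` (II (2.28) p. 563 *"configurations φ : Λ → R^N"*), the
field of the step being the exterior part of the datum `A_k` resp. `φ_k` glued with the interior coordinates (`fld37`); `Q_{l−k}`,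
`Q_{l−k}(Ã^{(k+1)})` are p23 g11's `avgQIter` (*"composed according to formula (I.2.12)"*); `Δ⁽ᵏ⁾` (vector: whole torus, field `0`,
mass `μ₀²`) and `Δ⁽ᵏ⁾(Bᵏ(Λ₂^{(k−1)′}), Ã⁽ᵏ⁾)` (mass `m²`) are p35's `deltaKA` at level `k`, exactly as lines 1 and 4 of (2.45) are
typed in `B2Eq245Assembled`.

WHAT IS PROVED (kernel-checked, 0 `sorry`, standard axioms; DEFINITIONS WITH BODY + theorems; NO `Prop`-valued fact).
 §0 `fld37 Λ ψ x = Λᶜψ + (x extended by zero)` and its calculus: `fld37_apply_of_mem/_of_not_mem`, `cutTo_fld37` (`Λ·fld37 = x`),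
    `cutTo_compl_fld37` (`Λᶜ·fld37 = Λᶜψ`), **`cutTo_compl_fld37_of_subset`** (`Λ ⊆ R ⇒ Rᶜ·fld37 = Rᶜψ`).
 §1 `Data37`; the five exponential lines `sqTerms37` (generic averaging squares; `sqVec37`, `sqScal37`), `dVec37`, `dScal37`,
    `hForm37`; `exponent37`; the prefactor `chiProd37`; **`display37`** = (3.7).
 §2 **`display37_factor`**: if `Λ₅⁽ᵏ⁾ ⊂ Λ₇^{(k−1)′}` (admissibility, p. 566, with (2.8)) the factor
    `ρ′⁽ᵏ⁾(…, Λ₇^{(k−1)′c}A_k, Ã⁽ᵏ⁾, Λ₇^{(k−1)′c}φ_k)` is the same for all values of the integrated fields and (3.7) =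
    `χ⋯χ · ρ′⁽ᵏ⁾(…) · ∫dA_k↾Λ₅∫dφ_k↾Λ₅ exp[…]` — the first instance of p. 585's *"after removing all the terms independent of these fields"*.
 §3 `linTerms37`, **`sqTerms37_add`** (the averaging squares at `ψ + B`: `‖·‖²` at `ψ`, minus twice the cross term, plus
    `Σ_n a_n(L^{k+n}ε)^{−2}‖Λ_{k+n}Q_nB‖²`) and **`sqTerms37_split`**: for `B` supported in `Λ₅⁽ᵏ⁾` the last sum IS
    `Geom39.sqForm39 … B` — *"the quadratic forms in A_k, φ_k connected with the first [two] terms"* of (3.9) are the quadratic parts of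
    the first two lines of (3.7) in the integrated fields; species instances `sqVec37_split`, `sqScal37_split` at the field of the step
    `fld37 Λ₅ ψ x = Λ₅ᶜψ + x`.
 §4 `exists_data37`: the datum is inhabited at every level `1 ≤ k ≤ K` (non-vacuity of the typing, zero fields).
HONEST SCOPE.  (a) (3.7) is a DISPLAY of §3.A's bookkeeping, not an inequality: this file gives it a body and proves only the two
structural sentences above; the steps of p. 584 between (3.7) and (3.9) (*"we apply formula (2.49) … replace ρ′⁽ᵏ⁾exp[…] by ρ⁽ᵏ⁾ …
complete and transform the quadratic forms … the differences … satisfying the property (3.8)"*, the forms `H′_k`, `H″_k`, `f′_k`, `f″_k`,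
`F′_k`, `F″_k`) are NOT here (rows B2.Eq2.44 (2.49), B2.Eq2.109, B2.Eq3.11's (3.12) files); in particular (3.7)'s `Δ⁽ᵏ⁾`-lines carry
the UNCONDITIONED operators while (3.9)'s third and fourth terms carry `Δ⁽ᵏ⁾_{Λ₅^{(k−1)}}` — that identification is the (2.49)/(2.46)
step, not claimed.  (b) Regions, fields, characteristic functions, `ρ′⁽ᵏ⁾` and `H_k` are DATA (print constructs them; instantiating
`Data37` from the tree's constructions is the consumer's bookkeeping, as for `Data245`); the only hypothesis used is `Λ₅⁽ᵏ⁾ ⊂ Λ₇^{(k−1)′}`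
(§2).  (c) The product of characteristic functions is typed as print writes it — OUTSIDE the integral, evaluated at the data fields
(print: *"χ_{l,Λ₅^{(l)c}} giving the suitable restrictions on the fields A_l, φ_l considered on the set Λ₅^{(l−1)′}∩Λ₅^{(l)c}"*, so
`χ_{k,Λ₅^{(k)c}}` does not see `A_k, φ_k↾Λ₅⁽ᵏ⁾`; not formalised as a hypothesis since nothing here uses it).  (d) No convergence
statement (the display is the Bochner integral of the carrier; for the nonnegative integrands of print both sides of §2 are the same
element of `[0, ∞]`, cf. `B2Eq246MaskedStep` HONEST SCOPE (c)).  (e) `1 ≤ k ≤ K` (`Geom39`: `k = j + 1`); at `k = K` (`M = 0`) the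
sums over `l` are empty and `χ_K` is the datum `chik`.  (f) Physical units (see above); vector fields in components on sites.
Value = the one absent member of row B2.Eq3.1-3.10 typed with a body on the carrier of record and tied to the (3.9) objects of record;
NOT summit progress.  No row head change is claimed (owner r02).
-/

noncomputable section

open scoped BigOperators InnerProductSpace
open MeasureTheory

namespace Literature.MathematicalPhysics.QuantumFieldTheory.Balaban1983to89.B2Eq37RemainingIntegral

open HiggsLattice HiggsAveraging HiggsCovariance HiggsCovariancePos HiggsFluctMeasurePos B1Eq27StepAdjoint B1Eq230FluctCov
  HiggsCondCov232 HiggsCondGauss228 B2Eq255Concrete B2Eq227CondDelta B2Eq39ConcreteForms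
open B2Eq228Conditioning (In Out resIn resOut glue)
open B3MultiscaleFields (zeroCharge)

variable {P : HiggsLattice.Params} {N : ℕ}

/-! ## §0 The field of the step: exterior part prescribed, interior coordinates free -/

section Fld

variable {k : ℕ}

/-- **The field `A_k` (resp. `φ_k`) of (3.7) as a function of the integration variable**: the configuration on `T⁽ᵏ⁾` whose
part outside `Λ = Λ₅⁽ᵏ⁾` is the prescribed field `ψ` and whose part inside `Λ` has the coordinates `x : Λ × {1,…,N} → ℝ` — `Λᶜψ`
plus `x` extended by zero (`HiggsCondGauss228.fieldOfCrd`, II (2.28) *"configurations φ : Λ → R^N"*).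
[cite: Balaban1982Higgs2, (3.7) p.584, (2.28) p.563] -/
def fld37 (Λ : Finset (HiggsLattice.Site P k)) (ψ : ScalarField P k N) (x : In (inSet (P := P) N Λ) → ℝ) :
    ScalarField P k N :=
  cutTo Λᶜ ψ + fieldOfCrd Λ x

/-- The zero extension of interior coordinates vanishes off `Λ`. [cite: Balaban1982Higgs2, (2.28) p.563] -/
theorem fieldOfCrd_apply_of_not_mem (Λ : Finset (HiggsLattice.Site P k)) (x : In (inSet (P := P) N Λ) → ℝ)
    {y : HiggsLattice.Site P k} (hy : y ∉ Λ) : fieldOfCrd Λ x y = 0 := by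
  have h := congrFun (cutTo_fieldOfCrd Λ x) y
  rw [cutTo_of_not_mem Λ _ hy] at h
  exact h.symm

/-- Inside `Λ` the field of the step is the integration variable. [cite: Balaban1982Higgs2, (3.7) p.584] -/
theorem fld37_apply_of_mem (Λ : Finset (HiggsLattice.Site P k)) (ψ : ScalarField P k N) (x : In (inSet (P := P) N Λ) → ℝ)
    {y : HiggsLattice.Site P k} (hy : y ∈ Λ) : fld37 Λ ψ x y = fieldOfCrd Λ x y := by
  have hy' : y ∉ Λᶜ := fun h => (Finset.mem_compl.mp h) hy
  simp only [fld37, Pi.add_apply, cutTo_of_not_mem Λᶜ ψ hy', zero_add]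

/-- Outside `Λ` the field of the step is the prescribed field. [cite: Balaban1982Higgs2, (3.7) p.584] -/
theorem fld37_apply_of_not_mem (Λ : Finset (HiggsLattice.Site P k)) (ψ : ScalarField P k N) (x : In (inSet (P := P) N Λ) → ℝ)
    {y : HiggsLattice.Site P k} (hy : y ∉ Λ) : fld37 Λ ψ x y = ψ y := by
  simp only [fld37, Pi.add_apply, cutTo_of_mem Λᶜ ψ (Finset.mem_compl.mpr hy), fieldOfCrd_apply_of_not_mem Λ x hy,
    add_zero]

/-- `Λ·(field of the step) = x` extended by zero. [cite: Balaban1982Higgs2, (3.7) p.584] -/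
theorem cutTo_fld37 (Λ : Finset (HiggsLattice.Site P k)) (ψ : ScalarField P k N) (x : In (inSet (P := P) N Λ) → ℝ) :
    cutTo Λ (fld37 Λ ψ x) = fieldOfCrd Λ x := by
  funext y
  by_cases hy : y ∈ Λ
  · rw [cutTo_of_mem Λ _ hy, fld37_apply_of_mem Λ ψ x hy]
  · rw [cutTo_of_not_mem Λ _ hy, fieldOfCrd_apply_of_not_mem Λ x hy]

/-- `Λᶜ·(field of the step) = Λᶜψ`. [cite: Balaban1982Higgs2, (3.7) p.584] -/
theorem cutTo_compl_fld37 (Λ : Finset (HiggsLattice.Site P k)) (ψ : ScalarField P k N) (x : In (inSet (P := P) N Λ) → ℝ) :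
    cutTo Λᶜ (fld37 Λ ψ x) = cutTo Λᶜ ψ := by
  funext y
  by_cases hy : y ∈ Λ
  · have hy' : y ∉ Λᶜ := fun h => (Finset.mem_compl.mp h) hy
    rw [cutTo_of_not_mem Λᶜ _ hy', cutTo_of_not_mem Λᶜ _ hy']
  · rw [cutTo_of_mem Λᶜ _ (Finset.mem_compl.mpr hy), cutTo_of_mem Λᶜ _ (Finset.mem_compl.mpr hy),
      fld37_apply_of_not_mem Λ ψ x hy]

/-- **A cut to the complement of a set containing `Λ` does not see the integration variable**: `Λ ⊆ R ⇒ Rᶜ·fld37 Λ ψ x = Rᶜψ`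
(used with `Λ = Λ₅⁽ᵏ⁾ ⊂ R = Λ₇^{(k−1)′}`: the arguments `Λ₇^{(k−1)′c}A_k`, `Λ₇^{(k−1)′c}φ_k` of `ρ′⁽ᵏ⁾` in (3.7)).
[cite: Balaban1982Higgs2, (3.7) p.584, (2.43) p.566] -/
theorem cutTo_compl_fld37_of_subset {Λ R : Finset (HiggsLattice.Site P k)} (h : Λ ⊆ R) (ψ : ScalarField P k N)
    (x : In (inSet (P := P) N Λ) → ℝ) : cutTo Rᶜ (fld37 Λ ψ x) = cutTo Rᶜ ψ := by
  funext y
  by_cases hy : y ∈ Rᶜ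
  · have hyΛ : y ∉ Λ := fun h' => (Finset.mem_compl.mp hy) (h h')
    rw [cutTo_of_mem Rᶜ _ hy, cutTo_of_mem Rᶜ _ hy, fld37_apply_of_not_mem Λ ψ x hyΛ]
  · rw [cutTo_of_not_mem Rᶜ _ hy, cutTo_of_not_mem Rᶜ _ hy]

/-- The field of the step decomposes as exterior part plus interior part (definitional). [cite: Balaban1982Higgs2, (3.7) p.584] -/
theorem fld37_eq (Λ : Finset (HiggsLattice.Site P k)) (ψ : ScalarField P k N) (x : In (inSet (P := P) N Λ) → ℝ) :
    fld37 Λ ψ x = cutTo Λᶜ ψ + fieldOfCrd Λ x := rfl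

end Fld

/-! ## §1 The data print attaches to (3.7) and the display -/

section Display

variable (P N) in
/-- **The data of ONE integral (3.7)** p. 584 at the scale `k` (`1 ≤ k ≤ K`): the geometry of p23 g11's (3.9)-object `Geom39`
(level `k = G.j + 1`, the region `Λ₅⁽ᵏ⁾` carrying the integrated fields, the conditioning blocks `Λ₅^{(k−1)′}`, the number
`M = K − k` of higher scales and the pieces `Λ₅^{(l−1)′}∩Λ₅^{(l)c} ⊂ T^{(l)}`, `l = k + n`, `n = 1,…,M`); the masks `Λ₆^{(k−1)′}`,
`Λ₇^{(k−1)′} ⊂ T⁽ᵏ⁾`; the Neumann region `Bᵏ(Λ₂^{(k−1)′}) ⊂ T_ε` of the scalar operator; the configurations `Ã⁽ᵏ⁾`, `Ã^{(k+1)}`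
of (3.4); the fields `A_k, φ_k` (data OUTSIDE `Λ₅⁽ᵏ⁾`; inside they are integrated) and `A_l, φ_l`, `l = k + n > k`; the characteristic
functions `χ_{k,Λ₅^{(k)c}}` and `χ_{l,Λ₅^{(l)c}}` (`k < l < K`), `χ_K` (the datum at `n = M`); the density `ρ′⁽ᵏ⁾(Λ₀⁽⁰⁾,…,Λ₀^{(k−1)},
A, Ã, φ)` as a function of `(A, Ã, φ)` ((2.47)); the operator `H_k` of (2.108) — all as NAMED DATA (print constructs them in
(2.7)–(2.8)′, (2.44), (2.47), (2.108), (3.2)–(3.4); cf. `B2Eq245Assembled.Data245`).  Vector fields in components on sites.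
[cite: Balaban1982Higgs2, (3.7) p.584] -/
structure Data37 where
  /-- the geometry of the integral: `k = G.j + 1`, `Λ₅⁽ᵏ⁾ = G.Λ5`, `M = K − k`, the pieces `G.reg n = Λ₅^{(k+n−1)′}∩Λ₅^{(k+n)c}`.
  [cite: Balaban1982Higgs2, (3.9) p.585] -/
  G : Geom39 P
  /-- `Λ₆^{(k−1)′} ⊂ T⁽ᵏ⁾` (the mask of the three operator lines). [cite: Balaban1982Higgs2, (3.7) p.584] -/
  R6p : Finset (HiggsLattice.Site P (G.j + 1))
  /-- `Λ₇^{(k−1)′} ⊂ T⁽ᵏ⁾` (the complement of the mask of the field arguments of `ρ′⁽ᵏ⁾`). [cite: Balaban1982Higgs2, (3.7) p.584] -/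
  R7p : Finset (HiggsLattice.Site P (G.j + 1))
  /-- `Bᵏ(Λ₂^{(k−1)′}) ⊂ T_ε`, the region of `Δ⁽ᵏ⁾(Bᵏ(Λ₂^{(k−1)′}), Ã⁽ᵏ⁾)`. [cite: Balaban1982Higgs2, (3.7) p.584] -/
  Ω : Finset (HiggsLattice.Site P 0)
  /-- `Ã⁽ᵏ⁾ = Ã^{(k),ε}` of (3.4) (the field of `ρ′⁽ᵏ⁾` and of the scalar operator). [cite: Balaban1982Higgs2, (3.4) p.583] -/
  Atk : HiggsLattice.VecField P 0
  /-- `Ã^{(k+1)} = Ã^{(k+1),ε}` of (3.4) (the field of the averagings `Q_{l−k}(Ã^{(k+1)})`). [cite: Balaban1982Higgs2, (3.4) p.583] -/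
  Atk1 : HiggsLattice.VecField P 0
  /-- `A_k` on `T⁽ᵏ⁾` (its values on `Λ₅⁽ᵏ⁾` are integrated out and immaterial). [cite: Balaban1982Higgs2, (3.7) p.584] -/
  Ak : ScalarField P (G.j + 1) P.d
  /-- `φ_k` on `T⁽ᵏ⁾` (its values on `Λ₅⁽ᵏ⁾` are integrated out and immaterial). [cite: Balaban1982Higgs2, (3.7) p.584] -/
  φk : ScalarField P (G.j + 1) N
  /-- `A_{k+n}` on `T^{(k+n)}`, `n = 1,…,M` (`A_K = B`, p. 583). [cite: Balaban1982Higgs2, (3.7) p.584] -/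
  A : (n : ℕ) → ScalarField P (G.j + 1 + n) P.d
  /-- `φ_{k+n}` on `T^{(k+n)}`, `n = 1,…,M` (`φ_K = ψ`, p. 583). [cite: Balaban1982Higgs2, (3.7) p.584] -/
  φ : (n : ℕ) → ScalarField P (G.j + 1 + n) N
  /-- `χ_{k,Λ₅^{(k)c}}`, a function of `(A_k, φ_k)` (at `k = K`: `χ_K`). [cite: Balaban1982Higgs2, (3.7) p.584] -/
  chik : ScalarField P (G.j + 1) P.d → ScalarField P (G.j + 1) N → ℝ
  /-- `χ_{k+n,Λ₅^{(k+n)c}}` for `1 ≤ n < M` and `χ_K` at `n = M`, functions of `(A_{k+n}, φ_{k+n})`. [cite: Balaban1982Higgs2, (3.7) p.584] -/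
  chi : (n : ℕ) → ScalarField P (G.j + 1 + n) P.d → ScalarField P (G.j + 1 + n) N → ℝ
  /-- `ρ′⁽ᵏ⁾(Λ₀⁽⁰⁾, …, Λ₀^{(k−1)}, A, Ã, φ)` as a function of `(A, Ã, φ)` ((2.47)). [cite: Balaban1982Higgs2, (2.47) p.568] -/
  rhoP : ScalarField P (G.j + 1) P.d → HiggsLattice.VecField P 0 → ScalarField P (G.j + 1) N → ℝ
  /-- `H_k`, the operator of the form `½⟨Λ₆^{(k−1)′}φ, H_kΛ₆^{(k−1)′}φ⟩` of (2.108) (its kernel obeys (3.8)). [cite: Balaban1982Higgs2, (2.108) p.580] -/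
  Hk : ScalarField P (G.j + 1) N →ₗ[ℝ] ScalarField P (G.j + 1) N

/-- **The averaging squares of (3.7)** (either species, in the fields `ψ` of the step at level `k = G.j + 1` against the data
fields `ext n` of the higher levels): `Σ_{n=1}^{M} a_n(L^{k+n}ε)^{−2}‖Λ_{k+n}(ext_n − Q_n(A_Q)ψ)‖²_{T^{(k+n)}}`, print's
`Σ_{l=k+1}^{K} a_{l−k}(L^{l−k})^{d−2}Σ_{x_l∈Λ₅^{(l−1)′}∩Λ₅^{(l)c}}|A_l(x_l) − (Q_{l−k}A_k)(x_l)|²` after *"rescaling from Lᵏε-lattice to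
1-lattice"* (`a_n = B1.aSeq a L n`, `Q_n(A_Q)` = p23 g11's `avgQIter`). [cite: Balaban1982Higgs2, (3.7) p.584] -/
def sqTerms37 {N' : ℕ} (C' : ChargeData N') (AQ : HiggsLattice.VecField P 0) (a : ℝ) (G : Geom39 P)
    (ext : (n : ℕ) → ScalarField P (G.j + 1 + n) N') (ψ : ScalarField P (G.j + 1) N') : ℝ :=
  ∑ n ∈ Finset.Icc 1 G.M, B1.aSeq a P.L n * (P.mesh (G.j + 1 + n))⁻¹ ^ 2 *
    siteInner (cutTo (G.reg n) (ext n - avgQIter C' AQ (G.j + 1) n ψ))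
      (cutTo (G.reg n) (ext n - avgQIter C' AQ (G.j + 1) n ψ))

variable (C : ChargeData N) (μ msq a : ℝ) (D : Data37 P N)

namespace Data37

/-- **Line 1 of the exponential of (3.7)** without its `−½`: the VECTOR averaging squares
`Σ_{l=k+1}^{K} a_{l−k}(L^{l−k})^{d−2}Σ_{x_l∈Λ₅^{(l−1)′}∩Λ₅^{(l)c}}|A_l(x_l) − (Q_{l−k}A_k)(x_l)|²` (plain block averagings: trivial
coupling, field `0`). [cite: Balaban1982Higgs2, (3.7) p.584] -/
def sqVec37 (Ak : ScalarField P (D.G.j + 1) P.d) : ℝ :=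
  sqTerms37 (zeroCharge P.d) (0 : HiggsLattice.VecField P 0) a D.G D.A Ak

/-- **Line 2 of the exponential of (3.7)** without its `−½`: the SCALAR averaging squares
`Σ_{l=k+1}^{K} a_{l−k}(L^{l−k})^{d−2}Σ_{x_l∈Λ₅^{(l−1)′}∩Λ₅^{(l)c}}|φ_l(x_l) − (Q_{l−k}(Ã^{(k+1)})φ_k)(x_l)|²`. [cite: Balaban1982Higgs2, (3.7) p.584] -/
def sqScal37 (φk : ScalarField P (D.G.j + 1) N) : ℝ :=
  sqTerms37 C D.Atk1 a D.G D.φ φk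

/-- **Line 3 of the exponential of (3.7)**: `−½⟨Λ₆^{(k−1)′}A_k, Δ⁽ᵏ⁾Λ₆^{(k−1)′}A_k⟩` (the vector operator `Δ^{(k),Lᵏε}`: trivial
coupling, whole torus, field `0`, mass `μ₀²` — p35's `deltaKA` at level `k`, as line 1 of (2.45) in `B2Eq245Assembled`).
[cite: Balaban1982Higgs2, (3.7) p.584] -/
def dVec37 (Ak : ScalarField P (D.G.j + 1) P.d) : ℝ :=
  -(1 / 2 : ℝ) * siteInner (cutTo D.R6p Ak)
    (deltaKA (zeroCharge P.d) Finset.univ (0 : HiggsLattice.VecField P 0) μ a (D.G.j + 1) (cutTo D.R6p Ak))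

/-- **Line 4 of the exponential of (3.7)**: `−½⟨Λ₆^{(k−1)′}φ_k, Δ⁽ᵏ⁾(Bᵏ(Λ₂^{(k−1)′}), Ã⁽ᵏ⁾)Λ₆^{(k−1)′}φ_k⟩` (`deltaKA C Ω Ã⁽ᵏ⁾ m² a` at
level `k`). [cite: Balaban1982Higgs2, (3.7) p.584] -/
def dScal37 (φk : ScalarField P (D.G.j + 1) N) : ℝ :=
  -(1 / 2 : ℝ) * siteInner (cutTo D.R6p φk) (deltaKA C D.Ω D.Atk msq a (D.G.j + 1) (cutTo D.R6p φk))

/-- **Line 5 of the exponential of (3.7)**: `+½⟨Λ₆^{(k−1)′}φ_k, H_kΛ₆^{(k−1)′}φ_k⟩` (*"we have applied formula (2.108) together with the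
remark following it"*). [cite: Balaban1982Higgs2, (3.7) p.584, (2.108) p.580] -/
def hForm37 (φk : ScalarField P (D.G.j + 1) N) : ℝ :=
  (1 / 2 : ℝ) * siteInner (cutTo D.R6p φk) (D.Hk (cutTo D.R6p φk))

/-- **The exponential bracket of (3.7)** as a function of the two fields of the step: `−½·(line-1 squares) − ½·(line-2 squares)
+ line 3 + line 4 + line 5`. [cite: Balaban1982Higgs2, (3.7) p.584] -/
def exponent37 (Ak : ScalarField P (D.G.j + 1) P.d) (φk : ScalarField P (D.G.j + 1) N) : ℝ :=
  -(1 / 2 : ℝ) * D.sqVec37 a Ak - (1 / 2 : ℝ) * D.sqScal37 C a φk + D.dVec37 μ a Ak + D.dScal37 C msq a φk + D.hForm37 φk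

/-- **The prefactor `χ_K χ_{K−1,Λ₅^{(K−1)c}} ⋯ χ_{k,Λ₅^{(k)c}}` of (3.7)**, each characteristic function evaluated at the fields of its
level (outside the integral, as printed). [cite: Balaban1982Higgs2, (3.7) p.584] -/
def chiProd37 : ℝ :=
  D.chik D.Ak D.φk * ∏ n ∈ Finset.Icc 1 D.G.M, D.chi n (D.A n) (D.φ n)

/-- **(3.7)** p. 584 [PDF 30] AS DISPLAYED (verbatim in the module header):
`χ_K χ_{K−1,Λ₅^{(K−1)c}} ⋯ χ_{k,Λ₅^{(k)c}} ∫dA_k↾_{Λ₅⁽ᵏ⁾} ∫dφ_k↾_{Λ₅⁽ᵏ⁾} ρ′⁽ᵏ⁾(Λ₀⁽⁰⁾, …, Λ₀^{(k−1)}, Λ₇^{(k−1)′c}A_k, Ã⁽ᵏ⁾, Λ₇^{(k−1)′c}φ_k) · exp[lines 1–5]`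
— the two integrals are the Lebesgue integrals over the coordinates of the fields INSIDE `Λ₅⁽ᵏ⁾` (I p. 605, II (2.28)), the field
of the step being the datum outside `Λ₅⁽ᵏ⁾` glued with the integration variable (`fld37`).  Convergence is not part of the display.
[cite: Balaban1982Higgs2, (3.7) p.584] -/
def display37 : ℝ :=
  D.chiProd37 *
    ∫ x : In (inSet (P := P) P.d D.G.Λ5) → ℝ, ∫ x' : In (inSet (P := P) N D.G.Λ5) → ℝ,
      D.rhoP (cutTo D.R7pᶜ (fld37 D.G.Λ5 D.Ak x)) D.Atk (cutTo D.R7pᶜ (fld37 D.G.Λ5 D.φk x'))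
        * Real.exp (D.exponent37 C μ msq a (fld37 D.G.Λ5 D.Ak x) (fld37 D.G.Λ5 D.φk x'))

/-- Unfolding of `display37` (definitional). [cite: Balaban1982Higgs2, (3.7) p.584] -/
theorem display37_eq :
    D.display37 C μ msq a
      = D.chiProd37 *
          ∫ x : In (inSet (P := P) P.d D.G.Λ5) → ℝ, ∫ x' : In (inSet (P := P) N D.G.Λ5) → ℝ,
            D.rhoP (cutTo D.R7pᶜ (fld37 D.G.Λ5 D.Ak x)) D.Atk (cutTo D.R7pᶜ (fld37 D.G.Λ5 D.φk x'))
              * Real.exp (D.exponent37 C μ msq a (fld37 D.G.Λ5 D.Ak x) (fld37 D.G.Λ5 D.φk x')) := rfl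

/-- Unfolding of the exponential bracket (definitional). [cite: Balaban1982Higgs2, (3.7) p.584] -/
theorem exponent37_eq (Ak : ScalarField P (D.G.j + 1) P.d) (φk : ScalarField P (D.G.j + 1) N) :
    D.exponent37 C μ msq a Ak φk
      = -(1 / 2 : ℝ) * sqTerms37 (zeroCharge P.d) (0 : HiggsLattice.VecField P 0) a D.G D.A Ak
        - (1 / 2 : ℝ) * sqTerms37 C D.Atk1 a D.G D.φ φk
        + -(1 / 2 : ℝ) * siteInner (cutTo D.R6p Ak)
            (deltaKA (zeroCharge P.d) Finset.univ (0 : HiggsLattice.VecField P 0) μ a (D.G.j + 1) (cutTo D.R6p Ak))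
        + -(1 / 2 : ℝ) * siteInner (cutTo D.R6p φk) (deltaKA C D.Ω D.Atk msq a (D.G.j + 1) (cutTo D.R6p φk))
        + (1 / 2 : ℝ) * siteInner (cutTo D.R6p φk) (D.Hk (cutTo D.R6p φk)) := rfl

/-! ## §2 The density factor does not see the integrated fields -/

/-- **`ρ′⁽ᵏ⁾(…, Λ₇^{(k−1)′c}A_k, Ã⁽ᵏ⁾, Λ₇^{(k−1)′c}φ_k)` IS CONSTANT IN THE INTEGRATION VARIABLES** when `Λ₅⁽ᵏ⁾ ⊂ Λ₇^{(k−1)′}`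
(admissibility `Λ₀⁽ᵏ⁾ ⊂ Λ₇^{(k−1)′}`, p. 566, with (2.8) `Λ₅⁽ᵏ⁾ ⊂ Λ₀⁽ᵏ⁾`): the cuts `Λ₇^{(k−1)′c}·` kill the part of the fields inside
`Λ₅⁽ᵏ⁾`. [cite: Balaban1982Higgs2, (3.7) p.584, (2.43) p.566] -/
theorem rhoArg_eq (h7 : D.G.Λ5 ⊆ D.R7p) (x : In (inSet (P := P) P.d D.G.Λ5) → ℝ) (x' : In (inSet (P := P) N D.G.Λ5) → ℝ) :
    D.rhoP (cutTo D.R7pᶜ (fld37 D.G.Λ5 D.Ak x)) D.Atk (cutTo D.R7pᶜ (fld37 D.G.Λ5 D.φk x'))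
      = D.rhoP (cutTo D.R7pᶜ D.Ak) D.Atk (cutTo D.R7pᶜ D.φk) := by
  rw [cutTo_compl_fld37_of_subset h7, cutTo_compl_fld37_of_subset h7]

/-- **(3.7) WITH THE DENSITY FACTOR OUTSIDE THE INTEGRAL** — the first instance of p. 585's *"after removing all the terms
independent of these fields"*: for `Λ₅⁽ᵏ⁾ ⊂ Λ₇^{(k−1)′}`,
`(3.7) = χ_K⋯χ_{k,Λ₅^{(k)c}} · ρ′⁽ᵏ⁾(…, Λ₇^{(k−1)′c}A_k, Ã⁽ᵏ⁾, Λ₇^{(k−1)′c}φ_k) · ∫dA_k↾_{Λ₅⁽ᵏ⁾}∫dφ_k↾_{Λ₅⁽ᵏ⁾} exp[lines 1–5]`.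
[cite: Balaban1982Higgs2, (3.7) p.584, (3.9) p.585] -/
theorem display37_factor (h7 : D.G.Λ5 ⊆ D.R7p) :
    D.display37 C μ msq a
      = D.chiProd37 * D.rhoP (cutTo D.R7pᶜ D.Ak) D.Atk (cutTo D.R7pᶜ D.φk) *
          ∫ x : In (inSet (P := P) P.d D.G.Λ5) → ℝ, ∫ x' : In (inSet (P := P) N D.G.Λ5) → ℝ,
            Real.exp (D.exponent37 C μ msq a (fld37 D.G.Λ5 D.Ak x) (fld37 D.G.Λ5 D.φk x')) := by
  rw [display37_eq]
  simp_rw [D.rhoArg_eq h7]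
  simp_rw [integral_const_mul]
  ring

end Data37

end Display

/-! ## §3 The quadratic part of the averaging lines in the integrated fields is the (3.9) object `Geom39.sqForm39` -/

section Split

variable {N' : ℕ} (C' : ChargeData N') (AQ : HiggsLattice.VecField P 0) (a : ℝ) (G : Geom39 P)
  (ext : (n : ℕ) → ScalarField P (G.j + 1 + n) N')

/-- **The cross terms** of the averaging squares between the field at `ψ` and a second field `B`:
`Σ_{n=1}^{M} a_n(L^{k+n}ε)^{−2}⟨Λ_{k+n}(ext_n − Q_nψ), Λ_{k+n}Q_nB⟩` (the linear-in-`B` part, up to the factor `−2`).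
[cite: Balaban1982Higgs2, (3.7) p.584, (3.9) p.585] -/
def linTerms37 (ψ B : ScalarField P (G.j + 1) N') : ℝ :=
  ∑ n ∈ Finset.Icc 1 G.M, B1.aSeq a P.L n * (P.mesh (G.j + 1 + n))⁻¹ ^ 2 *
    siteInner (cutTo (G.reg n) (ext n - avgQIter C' AQ (G.j + 1) n ψ))
      (cutTo (G.reg n) (avgQIter C' AQ (G.j + 1) n B))

/-- The square of one averaging line at `ψ + B`, expanded (bilinearity of the scalar product (I.1.5), linearity of `Q_n` and of the
cut): `‖Λ(e − Q(ψ + B))‖² = ‖Λ(e − Qψ)‖² − 2⟨Λ(e − Qψ), ΛQB⟩ + ‖ΛQB‖²`. [cite: Balaban1982Higgs2, (3.7) p.584] [folklore] -/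
theorem siteInner_sq_sub_add {l : ℕ} (Λ : Finset (HiggsLattice.Site P l)) (Q : ScalarField P (G.j + 1) N' →ₗ[ℝ] ScalarField P l N')
    (e : ScalarField P l N') (ψ B : ScalarField P (G.j + 1) N') :
    siteInner (cutTo Λ (e - Q (ψ + B))) (cutTo Λ (e - Q (ψ + B)))
      = siteInner (cutTo Λ (e - Q ψ)) (cutTo Λ (e - Q ψ))
        - 2 * siteInner (cutTo Λ (e - Q ψ)) (cutTo Λ (Q B))
        + siteInner (cutTo Λ (Q B)) (cutTo Λ (Q B)) := by
  have hsplit : cutTo Λ (e - Q (ψ + B)) = cutTo Λ (e - Q ψ) - cutTo Λ (Q B) := by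
    rw [map_add, ← sub_sub, ← cutToLin_apply, ← cutToLin_apply, ← cutToLin_apply, map_sub]
  rw [hsplit, siteInner_sub_right, siteInner_comm (cutTo Λ (e - Q ψ) - cutTo Λ (Q B)) (cutTo Λ (e - Q ψ)),
    siteInner_sub_right, siteInner_comm (cutTo Λ (e - Q ψ) - cutTo Λ (Q B)) (cutTo Λ (Q B)), siteInner_sub_right,
    siteInner_comm (cutTo Λ (Q B)) (cutTo Λ (e - Q ψ))]
  ring

/-- **THE AVERAGING SQUARES AT `ψ + B`**: `sqTerms37(ψ + B) = sqTerms37(ψ) − 2·linTerms37(ψ, B) + Σ_n a_n(L^{k+n}ε)^{−2}‖Λ_{k+n}Q_nB‖²`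
— constant, linear and quadratic parts in `B`. [cite: Balaban1982Higgs2, (3.7) p.584, (3.9) p.585] -/
theorem sqTerms37_add (ψ B : ScalarField P (G.j + 1) N') :
    sqTerms37 C' AQ a G ext (ψ + B)
      = sqTerms37 C' AQ a G ext ψ - 2 * linTerms37 C' AQ a G ext ψ B
        + ∑ n ∈ Finset.Icc 1 G.M, B1.aSeq a P.L n * (P.mesh (G.j + 1 + n))⁻¹ ^ 2 *
            siteInner (cutTo (G.reg n) (avgQIter C' AQ (G.j + 1) n B)) (cutTo (G.reg n) (avgQIter C' AQ (G.j + 1) n B)) := by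
  unfold sqTerms37 linTerms37
  rw [Finset.mul_sum, ← Finset.sum_sub_distrib, ← Finset.sum_add_distrib]
  refine Finset.sum_congr rfl fun n _ => ?_
  rw [siteInner_sq_sub_add G (G.reg n) (avgQIter C' AQ (G.j + 1) n) (ext n) ψ B]
  ring

/-- **THE QUADRATIC PART OF THE AVERAGING LINES OF (3.7) IN THE INTEGRATED FIELD IS THE (3.9) FORM**: for `B` supported in `Λ₅⁽ᵏ⁾`
(`Λ₅⁽ᵏ⁾B = B`), `sqTerms37(ψ + B) = sqTerms37(ψ) − 2·linTerms37(ψ, B) + Geom39.sqForm39 … B` — p23 g11's averaging squares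
`Σ_{l=k+1}^{K} a_{l−k}(L^{l−k})^{d−2}Σ_{x_l∈Λ₅^{(l−1)′}∩Λ₅^{(l)c}}|(Q_{l−k}(Ã)B)(x_l)|²`, *"the quadratic forms in A_k, φ_k connected with the
first [two] terms in the exponential under the integral (3.9)"*. [cite: Balaban1982Higgs2, (3.9) p.585, (3.7) p.584] -/
theorem sqTerms37_split (ψ B : ScalarField P (G.j + 1) N') (hB : cutTo G.Λ5 B = B) :
    sqTerms37 C' AQ a G ext (ψ + B)
      = sqTerms37 C' AQ a G ext ψ - 2 * linTerms37 C' AQ a G ext ψ B + G.sqForm39 C' AQ a B := by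
  rw [sqTerms37_add, Geom39.sqForm39, hB]

/-- **Vector species, at the field of the step**: the line-1 squares of (3.7) at `A_k = Λ₅ᶜA_k + x` are
`sqVec37(Λ₅ᶜA_k) − 2·(cross terms) + ⟨x, G′-squares x⟩` with the quadratic part p23 g11's `sqForm39` at trivial coupling (the
averaging part of `⟨A_k, G′_kA_k⟩`). [cite: Balaban1982Higgs2, (3.9) p.585, (3.7) p.584] -/
theorem Data37.sqVec37_split (D : Data37 P N) (x : In (inSet (P := P) P.d D.G.Λ5) → ℝ) :
    D.sqVec37 a (fld37 D.G.Λ5 D.Ak x)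
      = D.sqVec37 a (cutTo D.G.Λ5ᶜ D.Ak)
        - 2 * linTerms37 (zeroCharge P.d) (0 : HiggsLattice.VecField P 0) a D.G D.A (cutTo D.G.Λ5ᶜ D.Ak) (fieldOfCrd D.G.Λ5 x)
        + D.G.sqForm39 (zeroCharge P.d) (0 : HiggsLattice.VecField P 0) a (fieldOfCrd D.G.Λ5 x) := by
  rw [Data37.sqVec37, fld37_eq, sqTerms37_split _ _ _ _ _ _ _ (cutTo_fieldOfCrd D.G.Λ5 x)]
  rfl

/-- **Scalar species, at the field of the step**: the line-2 squares of (3.7) at `φ_k = Λ₅ᶜφ_k + x′` are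
`sqScal37(Λ₅ᶜφ_k) − 2·(cross terms) + ⟨x′, G″-squares x′⟩` with the quadratic part p23 g11's `sqForm39` at `(C, Ã^{(k+1)})` (the
averaging part of `⟨φ_k, G″_kφ_k⟩`). [cite: Balaban1982Higgs2, (3.9) p.585, (3.7) p.584] -/
theorem Data37.sqScal37_split (C : ChargeData N) (D : Data37 P N) (x' : In (inSet (P := P) N D.G.Λ5) → ℝ) :
    D.sqScal37 C a (fld37 D.G.Λ5 D.φk x')
      = D.sqScal37 C a (cutTo D.G.Λ5ᶜ D.φk)
        - 2 * linTerms37 C D.Atk1 a D.G D.φ (cutTo D.G.Λ5ᶜ D.φk) (fieldOfCrd D.G.Λ5 x')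
        + D.G.sqForm39 C D.Atk1 a (fieldOfCrd D.G.Λ5 x') := by
  rw [Data37.sqScal37, fld37_eq, sqTerms37_split _ _ _ _ _ _ _ (cutTo_fieldOfCrd D.G.Λ5 x')]
  rfl

end Split

/-! ## §4 Non-vacuity of the typing -/

/-- The datum of (3.7) is inhabited at every level `1 ≤ k ≤ K` (zero fields, unit characteristic functions and density, `H_k = 0`,
p23 g11's `exists_geom39` geometry). [cite: Balaban1982Higgs2, (3.7) p.584] -/
theorem exists_data37 {j : ℕ} (hj : j + 1 ≤ P.K) : ∃ D : Data37 P N, D.G.j = j ∧ D.G.M = P.K - (j + 1) := by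
  obtain ⟨G, hGj, hGM⟩ := exists_geom39 (P := P) hj
  exact ⟨⟨G, Finset.univ, Finset.univ, Finset.univ, 0, 0, 0, 0, fun _ => 0, fun _ => 0, fun _ _ => 1, fun _ _ _ => 1,
      fun _ _ _ => 1, 0⟩, hGj, hGM⟩

end Literature.MathematicalPhysics.QuantumFieldTheory.Balaban1983to89.B2Eq37RemainingIntegral

end
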